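import Literature.NumberTheory.Automorphic.GLnWhittakerRelevantOrbits
import Literature.NumberTheory.Automorphic.WhittakerModelsGelfandKazhdan
import Literature.NumberTheory.Automorphic.CompactOpenAveraging
import HarnessLib

/-!
# Bi-`ψ_U`-quasi-invariant test functions on `GL_n(F)`: the `(U_n × U_n)`-representation on
`C_c^∞(GL_n(F))`, its relation subspaces, twisted averaging, and the orbit lemmas

Topic `NumberTheory/Automorphic`. First half of the proof, for all `n`, of Gelfand–Kazhdan's
theorem on invariant distributions (Gelfand–Kazhdan 1975, §§3–4; Bernstein–Zelevinsky 1976,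
§§5.16–5.17 and §7; Bump 1997, Thm. 4.4.2 for `n = 2`): a distribution `Δ` on `GL_n(F)` with
`Δ(λ(u) φ) = ψ_U(u) Δ(φ)` and `Δ(ρ(u) φ) = ψ_U(u)⁻¹ Δ(φ)` is stable under `ι(g) = w⁰ ᵗg w⁰`. This file
sets up the coinvariant ("test function") side of the argument, in which no distribution, Haar
measure or function space on a subset of `GL_n(F)` is needed:

* `biRep`: the representation `(u₁, u₂) · f = λ(u₁) ρ(u₂) f` (`f ↦ f(u₁⁻¹ x u₂)`) of
  `H = U_n × U_n` on `𝒮(G) = C_c^∞(GL_n(F))` (`SchwartzBruhat`), the action `biAct (u₁, u₂) x =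
  u₁ x u₂⁻¹` on `G`, the character `biChar ψ (u₁, u₂) = ψ_U(u₁) ψ_U(u₂)⁻¹`, the involution
  `J f = f ∘ ι` (`SchwartzBruhat.compGKInvolution`) and the automorphism `flip (u₁, u₂) =
  (τ u₂, τ u₁)`, `τ(u) = ι(u⁻¹)`, with `ι(biAct h x) = biAct (flip h) (ι x)`, `J (h · f) = flip h · J f`
  and `biChar ∘ flip = biChar`;
* `biRelations ψ = span {h · f - biChar(h) f}` and `gkRelations ψ = biRelations ψ + span {J f + f}`:
  a distribution with Bump's two quasi-invariances (4.1) kills `biRelations`, and `Δ - Δ ∘ J` kills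
  `gkRelations`; hence **Theorem A follows from `gkRelations ψ = ⊤`**
  (`gkInvolution_stable_of_gkRelations_eq_top`);
* the **twisted averaging operators** `e = e_{V₀ × V₀}` of the `biChar⁻¹`-twist of `biRep` over
  `V₀ × V₀`, `V₀ ≤ U_n` compact open (the tree's `Representation.avgProj`, a finite transversal sum):
  `f - e f ∈ biRelations ψ` (`sub_avgProj_mem_biRelations`), the pointwise formula, the transformation
  rule `(e f)(h · x) = biChar(h)⁻¹ (e f)(x)` for `h ∈ V₀ × V₀` and the support rule;
* `τ`-stable compact open subgroups `V₀ ≤ U_n` containing any given compact set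
  (`exists_tauStable_compactOpen_subgroup`, from `isLimitOfCompactOpen_upperUnitriangular`);
* the **orbit lemmas** on a Borel cell `C_σ` (`BorelBruhatCellsGK`): if every point `y` of the
  cell in the support of `f` is `h · m_y` with `h ∈ V₀ × V₀` and `m_y = (cellTorus σ y) P_σ` its
  monomial representative, then (i) `e f` vanishes on the orbit of `m_y` as soon as some
  `s ∈ V₀ × V₀` stabilises `m_y` with `biChar(s) ≠ 1` (*irrelevant orbit*,
  `avgProj_apply_eq_zero_of_stabilizer`), and (ii) `(e f)(ι y) = (e f)(y)` on the orbit when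
  `ι(m_y) = m_y` and the cell is `ι`-stable (*relevant orbit*, `avgProj_apply_gkInvolution`).

Everything is a definition with a body or a proved theorem; no named fact is introduced.

## References

* I. M. Gelfand, D. A. Kazhdan, *Representations of the group GL(n, K) where K is a local field*,
  in: Lie groups and their representations (Budapest 1971), Halsted (1975), 95–118, §§3–4.
  [GelfandKazhdan1975]
* I. N. Bernstein, A. V. Zelevinsky, *Representations of the group GL(n, F) where F is a
  non-archimedean local field*, Russian Math. Surveys 31:3 (1976), 1–68, §§5.16–5.17, §6
  (localization principle and Gelfand–Kazhdan's method), §7 (not held). [BernsteinZelevinskyRMS1976]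
* I. N. Bernstein, A. V. Zelevinsky, *Induced representations of reductive `p`-adic groups I*,
  Ann. Sci. ÉNS 10 (1977), §1.8 (b), §1.9 (held). [BernsteinZelevinskyASENS1977]
* D. Bump, *Automorphic Forms and Representations* (1997), §4.4, Theorem 4.4.2 and its proof for
  `GL(2)`, pp. 455–457 (Propositions 4.3.2–4.3.3 on distributions quasi-invariant under a
  compact open subgroup). [Bump1997]
-/

open Matrix
open scoped Pointwise

namespace Literature.NumberTheory.Automorphic

section LocalField

variable {F : Type*} [Field F] [ValuativeRel F] [TopologicalSpace F] [IsNonarchimedeanLocalField F]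
  {n : ℕ}

attribute [local instance] t2Space_generalLinearGroup locallyCompactSpace_generalLinearGroup
  nonarchimedeanGroup_gl sigmaCompactSpace_generalLinearGroup

/-! ### The action of `U_n × U_n` on `GL_n(F)` and on test functions -/

/-- The action `(u₁, u₂) · x = u₁ x u₂⁻¹` of `U_n × U_n` on `GL_n(F)`. [folklore] -/
def biAct (h : ↥(upperUnitriangular (Fin n) F) × ↥(upperUnitriangular (Fin n) F)) (x : GL (Fin n) F) :
    GL (Fin n) F :=
  (h.1 : GL (Fin n) F) * x * ((h.2 : GL (Fin n) F))⁻¹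

omit [ValuativeRel F] [TopologicalSpace F] [IsNonarchimedeanLocalField F] in
/-- Unfolding lemma for `biAct`. [folklore] -/
lemma biAct_apply (h : ↥(upperUnitriangular (Fin n) F) × ↥(upperUnitriangular (Fin n) F))
    (x : GL (Fin n) F) : biAct h x = (h.1 : GL (Fin n) F) * x * ((h.2 : GL (Fin n) F))⁻¹ := rfl

omit [ValuativeRel F] [TopologicalSpace F] [IsNonarchimedeanLocalField F] in
/-- `1 · x = x`. [folklore] -/
@[simp] lemma biAct_one (x : GL (Fin n) F) : biAct (1 : ↥(upperUnitriangular (Fin n) F) × _) x = x := by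
  simp [biAct]

omit [ValuativeRel F] [TopologicalSpace F] [IsNonarchimedeanLocalField F] in
/-- `(h h') · x = h · (h' · x)`. [folklore] -/
lemma biAct_mul (h h' : ↥(upperUnitriangular (Fin n) F) × ↥(upperUnitriangular (Fin n) F))
    (x : GL (Fin n) F) : biAct (h * h') x = biAct h (biAct h' x) := by
  simp only [biAct, Prod.fst_mul, Prod.snd_mul, Subgroup.coe_mul, _root_.mul_inv_rev, mul_assoc]

omit [ValuativeRel F] [TopologicalSpace F] [IsNonarchimedeanLocalField F] in
/-- `h⁻¹ · (h · x) = x`. [folklore] -/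
@[simp] lemma biAct_inv_biAct (h : ↥(upperUnitriangular (Fin n) F) × ↥(upperUnitriangular (Fin n) F))
    (x : GL (Fin n) F) : biAct h⁻¹ (biAct h x) = x := by
  rw [← biAct_mul, inv_mul_cancel, biAct_one]

omit [ValuativeRel F] [TopologicalSpace F] [IsNonarchimedeanLocalField F] in
/-- `h · (h⁻¹ · x) = x`. [folklore] -/
@[simp] lemma biAct_biAct_inv (h : ↥(upperUnitriangular (Fin n) F) × ↥(upperUnitriangular (Fin n) F))
    (x : GL (Fin n) F) : biAct h (biAct h⁻¹ x) = x := by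
  rw [← biAct_mul, mul_inv_cancel, biAct_one]

/-- **The representation `(u₁, u₂) · f = λ(u₁) ρ(u₂) f` of `U_n × U_n` on `C_c^∞(GL_n(F))`**
(Bump 1997, (3.4)–(3.5), p. 435: `(λ(u) f)(x) = f(u⁻¹ x)`, `(ρ(u) f)(x) = f(x u)`), i.e.
`(h · f)(x) = f(h⁻¹ · x)`. [cite: Bump1997, (3.4)-(3.5), p. 435] -/
noncomputable def biRep :
    Representation ℂ (↥(upperUnitriangular (Fin n) F) × ↥(upperUnitriangular (Fin n) F))
      (SchwartzBruhat (GL (Fin n) F)) where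
  toFun h := SchwartzBruhat.leftTranslate (h.1 : GL (Fin n) F) ∘ₗ
    SchwartzBruhat.rightTranslate (h.2 : GL (Fin n) F)
  map_one' := by
    apply LinearMap.ext; intro f; apply Subtype.ext; funext x
    simp
  map_mul' h h' := by
    apply LinearMap.ext; intro f; apply Subtype.ext; funext x
    simp [mul_assoc]

/-- `(h · f)(x) = f(h₁⁻¹ x h₂) = f(h⁻¹ · x)`. [folklore] -/
lemma biRep_apply_apply (h : ↥(upperUnitriangular (Fin n) F) × ↥(upperUnitriangular (Fin n) F))
    (f : SchwartzBruhat (GL (Fin n) F)) (x : GL (Fin n) F) :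
    (biRep h f : GL (Fin n) F → ℂ) x = (f : GL (Fin n) F → ℂ) (biAct h⁻¹ x) := by
  simp [biRep, biAct, mul_assoc]

variable (ψ : AddChar F Circle)

/-- **The character `(u₁, u₂) ↦ ψ_U(u₁) ψ_U(u₂)⁻¹`** of `U_n × U_n` (the quasi-invariance type
(4.1) of Bump 1997, p. 455, for the action `λ(u₁) ρ(u₂)`). [cite: Bump1997, (4.1), p. 455] -/
noncomputable def biChar : ↥(upperUnitriangular (Fin n) F) × ↥(upperUnitriangular (Fin n) F) →* ℂˣ :=
  ((whittakerChar ψ).comp (MonoidHom.fst _ _)) * ((whittakerChar ψ).comp (MonoidHom.snd _ _))⁻¹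

omit [ValuativeRel F] [TopologicalSpace F] [IsNonarchimedeanLocalField F] in
/-- `biChar ψ (u₁, u₂) = ψ_U(u₁) ψ_U(u₂)⁻¹` in `ℂ`. [folklore] -/
lemma coe_biChar_apply (h : ↥(upperUnitriangular (Fin n) F) × ↥(upperUnitriangular (Fin n) F)) :
    ((biChar ψ h : ℂˣ) : ℂ) = whittakerCharFun ψ h.1 * (whittakerCharFun ψ h.2)⁻¹ := by
  simp [biChar, Units.val_inv_eq_inv_val]

/-- **A bi-`ψ_U`-quasi-invariant distribution transforms by `biChar` under `biRep`**:
`Δ(h · f) = biChar(h) Δ(f)` when `Δ(λ(u) φ) = ψ_U(u) Δ(φ)` and `Δ(ρ(u) φ) = ψ_U(u)⁻¹ Δ(φ)`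
(Bump 1997, (4.1)). [cite: Bump1997, (4.1), p. 455] -/
theorem apply_biRep_of_quasiInvariant {Δ : Module.Dual ℂ (SchwartzBruhat (GL (Fin n) F))}
    (hl : ∀ (u : ↥(upperUnitriangular (Fin n) F)) (φ : SchwartzBruhat (GL (Fin n) F)),
      Δ (SchwartzBruhat.leftTranslate (u : GL (Fin n) F) φ) = whittakerCharFun ψ u * Δ φ)
    (hr : ∀ (u : ↥(upperUnitriangular (Fin n) F)) (φ : SchwartzBruhat (GL (Fin n) F)),
      Δ (SchwartzBruhat.rightTranslate (u : GL (Fin n) F) φ) = (whittakerCharFun ψ u)⁻¹ * Δ φ)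
    (h : ↥(upperUnitriangular (Fin n) F) × ↥(upperUnitriangular (Fin n) F))
    (f : SchwartzBruhat (GL (Fin n) F)) : Δ (biRep h f) = (biChar ψ h : ℂ) * Δ f := by
  change Δ (SchwartzBruhat.leftTranslate (h.1 : GL (Fin n) F)
    (SchwartzBruhat.rightTranslate (h.2 : GL (Fin n) F) f)) = _
  rw [hl, hr, coe_biChar_apply, mul_assoc]

/-! ### The involutions `J f = f ∘ ι` and `flip (u₁, u₂) = (τ u₂, τ u₁)` -/

/-- The automorphism `τ(u) = ι(u⁻¹)` of `GL_n(F)` restricted to `U_n`: the map `u ↦ ι(u⁻¹) ∈ U_n`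
(`ι(U_n) = U_n`). [folklore] -/
noncomputable def tauU (u : ↥(upperUnitriangular (Fin n) F)) : ↥(upperUnitriangular (Fin n) F) :=
  ⟨gkInvolution (u : GL (Fin n) F)⁻¹,
    gkInvolution_mem_upperUnitriangular ((upperUnitriangular (Fin n) F).inv_mem u.2)⟩

omit [ValuativeRel F] [IsNonarchimedeanLocalField F] in
/-- The matrix of `tauU u` is `ι(u⁻¹)`. [folklore] -/
@[simp] lemma coe_tauU (u : ↥(upperUnitriangular (Fin n) F)) :
    ((tauU u : ↥(upperUnitriangular (Fin n) F)) : GL (Fin n) F) = gkInvolution (u : GL (Fin n) F)⁻¹ := rfl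

omit [ValuativeRel F] [IsNonarchimedeanLocalField F] in
/-- `τ` is an involution on `U_n`. [folklore] -/
@[simp] lemma tauU_tauU (u : ↥(upperUnitriangular (Fin n) F)) : tauU (tauU u) = u := by
  apply Subtype.ext
  rw [coe_tauU, coe_tauU, ← gkInvolution_inv, inv_inv, gkInvolution_gkInvolution]

omit [ValuativeRel F] [IsNonarchimedeanLocalField F] in
/-- `τ` is multiplicative on `U_n`. [folklore] -/
lemma tauU_mul (u v : ↥(upperUnitriangular (Fin n) F)) : tauU (u * v) = tauU u * tauU v := by
  apply Subtype.ext
  simp only [coe_tauU, Subgroup.coe_mul, _root_.mul_inv_rev, gkInvolution_mul]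

omit [ValuativeRel F] [IsNonarchimedeanLocalField F] in
/-- `τ(1) = 1`. [folklore] -/
@[simp] lemma tauU_one : tauU (1 : ↥(upperUnitriangular (Fin n) F)) = 1 := by
  apply Subtype.ext
  simp only [coe_tauU, Subgroup.coe_one, inv_one, gkInvolution_one]

omit [ValuativeRel F] [IsNonarchimedeanLocalField F] in
/-- `τ(u⁻¹) = τ(u)⁻¹`. [folklore] -/
lemma tauU_inv (u : ↥(upperUnitriangular (Fin n) F)) : tauU u⁻¹ = (tauU u)⁻¹ := by
  apply Subtype.ext
  simp only [coe_tauU, Subgroup.coe_inv, inv_inv, gkInvolution_inv]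

omit [ValuativeRel F] [IsNonarchimedeanLocalField F] in
/-- `ψ_U(τ u) = ψ_U(u)⁻¹` (`ψ_U ∘ ι = ψ_U`, Bump 1997, p. 455). [cite: Bump1997, §4.4, p. 455] -/
lemma whittakerCharFun_tauU (u : ↥(upperUnitriangular (Fin n) F)) :
    whittakerCharFun ψ (tauU u) = (whittakerCharFun ψ u)⁻¹ := by
  have : tauU u = ⟨gkInvolution ((u⁻¹ : ↥(upperUnitriangular (Fin n) F)) : GL (Fin n) F),
      gkInvolution_mem_upperUnitriangular (u⁻¹).2⟩ := Subtype.ext (by simp [coe_tauU])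
  rw [this, whittakerCharFun_gkInvolution, whittakerCharFun_inv_eq_inv]

/-- **The flip** `(u₁, u₂) ↦ (τ u₂, τ u₁)` of `U_n × U_n`: the automorphism through which `ι`
intertwines the action, `ι(h · x) = flip(h) · ι(x)`. [folklore] -/
noncomputable def flipU (h : ↥(upperUnitriangular (Fin n) F) × ↥(upperUnitriangular (Fin n) F)) :
    ↥(upperUnitriangular (Fin n) F) × ↥(upperUnitriangular (Fin n) F) :=
  (tauU h.2, tauU h.1)

omit [ValuativeRel F] [IsNonarchimedeanLocalField F] in
/-- Components of the flip. [folklore] -/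
@[simp] lemma flipU_fst (h : ↥(upperUnitriangular (Fin n) F) × ↥(upperUnitriangular (Fin n) F)) :
    (flipU h).1 = tauU h.2 := rfl

omit [ValuativeRel F] [IsNonarchimedeanLocalField F] in
/-- Components of the flip. [folklore] -/
@[simp] lemma flipU_snd (h : ↥(upperUnitriangular (Fin n) F) × ↥(upperUnitriangular (Fin n) F)) :
    (flipU h).2 = tauU h.1 := rfl

omit [ValuativeRel F] [IsNonarchimedeanLocalField F] in
/-- The flip is an involution. [folklore] -/
@[simp] lemma flipU_flipU (h : ↥(upperUnitriangular (Fin n) F) × ↥(upperUnitriangular (Fin n) F)) :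
    flipU (flipU h) = h := by
  ext <;> simp [flipU]

omit [ValuativeRel F] [IsNonarchimedeanLocalField F] in
/-- The flip is multiplicative. [folklore] -/
lemma flipU_mul (h h' : ↥(upperUnitriangular (Fin n) F) × ↥(upperUnitriangular (Fin n) F)) :
    flipU (h * h') = flipU h * flipU h' := by
  ext <;> simp [flipU, tauU_mul]

omit [ValuativeRel F] [IsNonarchimedeanLocalField F] in
/-- The flip commutes with inversion. [folklore] -/
lemma flipU_inv (h : ↥(upperUnitriangular (Fin n) F) × ↥(upperUnitriangular (Fin n) F)) :
    flipU h⁻¹ = (flipU h)⁻¹ := by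
  ext <;> simp [flipU, tauU_inv]

omit [ValuativeRel F] [IsNonarchimedeanLocalField F] in
/-- **`ι(h · x) = flip(h) · ι(x)`**: the anti-involution `ι` exchanges left and right
translations. [folklore] -/
lemma gkInvolution_biAct (h : ↥(upperUnitriangular (Fin n) F) × ↥(upperUnitriangular (Fin n) F))
    (x : GL (Fin n) F) : gkInvolution (biAct h x) = biAct (flipU h) (gkInvolution x) := by
  simp only [biAct, flipU_fst, flipU_snd, coe_tauU, gkInvolution_mul, gkInvolution_inv, inv_inv,
    mul_assoc]

omit [ValuativeRel F] [IsNonarchimedeanLocalField F] in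
/-- **`biChar ∘ flip = biChar`**: `ψ_U(τ u₂) ψ_U(τ u₁)⁻¹ = ψ_U(u₁) ψ_U(u₂)⁻¹`. [folklore] -/
lemma biChar_flipU (h : ↥(upperUnitriangular (Fin n) F) × ↥(upperUnitriangular (Fin n) F)) :
    biChar ψ (flipU h) = biChar ψ h := by
  apply Units.ext
  rw [coe_biChar_apply, coe_biChar_apply, flipU_fst, flipU_snd, whittakerCharFun_tauU,
    whittakerCharFun_tauU, inv_inv, mul_comm]

/-- `J` is an involution: `(f ∘ ι) ∘ ι = f`. [folklore] -/
@[simp] lemma compGKInvolution_compGKInvolution (f : SchwartzBruhat (GL (Fin n) F)) :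
    SchwartzBruhat.compGKInvolution (SchwartzBruhat.compGKInvolution f) = f := by
  apply Subtype.ext; funext x
  simp only [SchwartzBruhat.compGKInvolution_apply, gkInvolution_gkInvolution]

/-- **`J (h · f) = flip(h) · J f`**. [folklore] -/
lemma compGKInvolution_biRep (h : ↥(upperUnitriangular (Fin n) F) × ↥(upperUnitriangular (Fin n) F))
    (f : SchwartzBruhat (GL (Fin n) F)) :
    SchwartzBruhat.compGKInvolution (biRep h f) = biRep (flipU h) (SchwartzBruhat.compGKInvolution f) := by
  apply Subtype.ext; funext x
  rw [SchwartzBruhat.compGKInvolution_apply, biRep_apply_apply, biRep_apply_apply,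
    SchwartzBruhat.compGKInvolution_apply, gkInvolution_biAct, flipU_inv, flipU_flipU]

/-! ### The relation subspaces and the reduction of Theorem A to `gkRelations ψ = ⊤` -/

/-- The subspace `span {h · f - biChar(h) f}` of `C_c^∞(GL_n(F))` killed by every
bi-`ψ_U`-quasi-invariant distribution: the kernel of the `θ`-coinvariants (`θ = biChar`) of
`biRep` (Bernstein–Zelevinsky 1977, §1.8 (b), the `θ`-localisation; cf. the tree's
`Representation.ker_charTwist_eq_span`). [cite: BernsteinZelevinskyASENS1977, §1.8 (b)] -/
noncomputable def biRelations : Submodule ℂ (SchwartzBruhat (GL (Fin n) F)) :=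
  Submodule.span ℂ (Set.range fun p : (↥(upperUnitriangular (Fin n) F) × ↥(upperUnitriangular (Fin n) F)) ×
    SchwartzBruhat (GL (Fin n) F) => biRep p.1 p.2 - (biChar ψ p.1 : ℂ) • p.2)

/-- The subspace `gkRelations ψ = biRelations ψ + span {J f + f}` killed by every
bi-`ψ_U`-quasi-invariant distribution that is *anti*-invariant under `J`. [folklore] -/
noncomputable def gkRelations : Submodule ℂ (SchwartzBruhat (GL (Fin n) F)) :=
  biRelations ψ ⊔ Submodule.span ℂ (Set.range fun f : SchwartzBruhat (GL (Fin n) F) =>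
    SchwartzBruhat.compGKInvolution f + f)

/-- Generators of `biRelations`. [folklore] -/
lemma biRep_sub_smul_mem_biRelations (h : ↥(upperUnitriangular (Fin n) F) × ↥(upperUnitriangular (Fin n) F))
    (f : SchwartzBruhat (GL (Fin n) F)) : biRep h f - (biChar ψ h : ℂ) • f ∈ biRelations ψ :=
  Submodule.subset_span ⟨(h, f), rfl⟩

/-- `biRelations ≤ gkRelations`. [folklore] -/
lemma biRelations_le_gkRelations : biRelations (n := n) ψ ≤ gkRelations ψ := le_sup_left

/-- Generators of the second kind of `gkRelations`: `J f + f`. [folklore] -/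
lemma compGKInvolution_add_mem_gkRelations (f : SchwartzBruhat (GL (Fin n) F)) :
    SchwartzBruhat.compGKInvolution f + f ∈ gkRelations ψ :=
  Submodule.mem_sup_right (Submodule.subset_span ⟨f, rfl⟩)

/-- If `f - J f ∈ gkRelations` then `f ∈ gkRelations` (`2 f = (f - J f) + (J f + f)`). [folklore] -/
lemma mem_gkRelations_of_sub_compGKInvolution_mem {f : SchwartzBruhat (GL (Fin n) F)}
    (h : f - SchwartzBruhat.compGKInvolution f ∈ gkRelations ψ) : f ∈ gkRelations ψ := by
  have h2 : (2 : ℂ) • f = (f - SchwartzBruhat.compGKInvolution f) +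
      (SchwartzBruhat.compGKInvolution f + f) := by
    rw [two_smul]; abel
  have h3 : (2 : ℂ) • f ∈ gkRelations ψ := by
    rw [h2]; exact Submodule.add_mem _ h (compGKInvolution_add_mem_gkRelations ψ f)
  have := Submodule.smul_mem (gkRelations ψ) ((2 : ℂ)⁻¹) h3
  rwa [smul_smul, inv_mul_cancel₀ (two_ne_zero' ℂ), one_smul] at this

/-- **Theorem A from `gkRelations ψ = ⊤`** (the coinvariant form of Gelfand–Kazhdan's theorem): if
every test function lies in `gkRelations ψ`, then every bi-`ψ_U`-quasi-invariant distribution `Δ`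
(Bump's (4.1)) is `ι`-stable. Indeed `D = Δ - Δ ∘ J` kills the generators `h · f - biChar(h) f`
(using `J(h · f) = flip(h) · J f`, `biChar ∘ flip = biChar`) and `J f + f` (using `J² = 1`).
[cite: Bump1997, Theorem 4.4.2, p. 455] -/
theorem gkInvolution_stable_of_gkRelations_eq_top (htop : gkRelations (n := n) ψ = ⊤)
    (Δ : Module.Dual ℂ (SchwartzBruhat (GL (Fin n) F)))
    (hl : ∀ (u : ↥(upperUnitriangular (Fin n) F)) (φ : SchwartzBruhat (GL (Fin n) F)),
      Δ (SchwartzBruhat.leftTranslate (u : GL (Fin n) F) φ) = whittakerCharFun ψ u * Δ φ)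
    (hr : ∀ (u : ↥(upperUnitriangular (Fin n) F)) (φ : SchwartzBruhat (GL (Fin n) F)),
      Δ (SchwartzBruhat.rightTranslate (u : GL (Fin n) F) φ) = (whittakerCharFun ψ u)⁻¹ * Δ φ)
    (φ : SchwartzBruhat (GL (Fin n) F)) : Δ (SchwartzBruhat.compGKInvolution φ) = Δ φ := by
  set D : Module.Dual ℂ (SchwartzBruhat (GL (Fin n) F)) :=
    Δ - Δ ∘ₗ SchwartzBruhat.compGKInvolution with hD
  have hD0 : ∀ f ∈ gkRelations ψ, D f = 0 := by
    intro f hf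
    obtain ⟨f₁, hf₁, f₂, hf₂, rfl⟩ := Submodule.mem_sup.1 hf
    rw [map_add]
    have h1 : D f₁ = 0 := by
      refine Submodule.span_induction (p := fun g _ => D g = 0) ?_ (map_zero D)
        (fun _ _ _ _ ha hb => by rw [map_add, ha, hb, add_zero])
        (fun c _ _ ha => by rw [map_smul, ha, smul_zero]) hf₁
      rintro _ ⟨⟨h, g⟩, rfl⟩
      simp only [hD, LinearMap.sub_apply, LinearMap.comp_apply, map_sub, map_smul, smul_eq_mul,
        compGKInvolution_biRep, apply_biRep_of_quasiInvariant ψ hl hr, biChar_flipU]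
      ring
    have h2 : D f₂ = 0 := by
      refine Submodule.span_induction (p := fun g _ => D g = 0) ?_ (map_zero D)
        (fun _ _ _ _ ha hb => by rw [map_add, ha, hb, add_zero])
        (fun c _ _ ha => by rw [map_smul, ha, smul_zero]) hf₂
      rintro _ ⟨g, rfl⟩
      simp only [hD, LinearMap.sub_apply, LinearMap.comp_apply, map_add,
        compGKInvolution_compGKInvolution]
      ring
    rw [h1, h2, add_zero]
  have := hD0 φ (htop ▸ Submodule.mem_top)
  rw [hD, LinearMap.sub_apply, LinearMap.comp_apply, sub_eq_zero] at this
  exact this.symm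

/-! ### The `biChar⁻¹`-twist of `biRep` and its smoothness -/

/-- The twisted representation `h ↦ biChar(h)⁻¹ · (h · f)`, whose fixed vectors under a subgroup
`S ≤ U_n × U_n` are the `(S, biChar)`-quasi-invariant test functions and whose coinvariant kernel
is spanned by `biRelations` (the tree's `Representation.twist` by `(biChar ψ)⁻¹`). [folklore] -/
noncomputable def biRepTwist :
    Representation ℂ (↥(upperUnitriangular (Fin n) F) × ↥(upperUnitriangular (Fin n) F))
      (SchwartzBruhat (GL (Fin n) F)) :=
  (biRep (F := F) (n := n)).twist (biChar ψ)⁻¹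

/-- `biRepTwist ψ h f = biChar(h)⁻¹ • (h · f)`. [folklore] -/
lemma biRepTwist_apply (h : ↥(upperUnitriangular (Fin n) F) × ↥(upperUnitriangular (Fin n) F))
    (f : SchwartzBruhat (GL (Fin n) F)) :
    biRepTwist ψ h f = (((biChar ψ h)⁻¹ : ℂˣ) : ℂ) • biRep h f := by
  rw [biRepTwist, Representation.twist_apply, MonoidHom.inv_apply]

/-- Pointwise: `(biRepTwist ψ h f)(x) = biChar(h)⁻¹ f(h⁻¹ · x)`. [folklore] -/
lemma biRepTwist_apply_apply (h : ↥(upperUnitriangular (Fin n) F) × ↥(upperUnitriangular (Fin n) F))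
    (f : SchwartzBruhat (GL (Fin n) F)) (x : GL (Fin n) F) :
    (biRepTwist ψ h f : GL (Fin n) F → ℂ) x = ((biChar ψ h : ℂˣ) : ℂ)⁻¹ * (f : GL (Fin n) F → ℂ) (biAct h⁻¹ x) := by
  rw [biRepTwist_apply, Submodule.coe_smul, Pi.smul_apply, smul_eq_mul, biRep_apply_apply,
    Units.val_inv_eq_inv_val]

/-- **Test functions are smooth vectors of the twisted representation** (uniform local constancy:
`f` is bi-invariant under a compact open subgroup `K` of `GL_n(F)`, and `ψ_U` is trivial near `1`).
[folklore] -/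
theorem isSmoothVector_biRepTwist (hψ : Continuous ψ) (f : SchwartzBruhat (GL (Fin n) F)) :
    (biRepTwist ψ).IsSmoothVector f := by
  obtain ⟨K, hKo, -, hR, hL⟩ := exists_isCompact_isOpen_forall_mul_eq f.2
  set K' : Subgroup ↥(upperUnitriangular (Fin n) F) :=
    K.comap (upperUnitriangular (Fin n) F).subtype ⊓ (whittakerChar ψ).ker with hK'
  have hK'o : IsOpen (K' : Set ↥(upperUnitriangular (Fin n) F)) :=
    (hKo.preimage continuous_subtype_val).inter (isOpen_ker_whittakerChar hψ)
  refine (biRepTwist ψ).isSmoothVector_of_le (K := K'.prod K') ?_ fun h hh => ?_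
  · rw [Subgroup.coe_prod]
    exact hK'o.prod hK'o
  · obtain ⟨⟨h1K, h1ker⟩, ⟨h2K, h2ker⟩⟩ := Subgroup.mem_prod.1 hh
    rw [Representation.mem_stabilizerSubgroup]
    apply Subtype.ext
    funext x
    have hχ : ((biChar ψ h : ℂˣ) : ℂ) = 1 := by
      rw [coe_biChar_apply, (mem_ker_whittakerChar_iff ψ _).1 h1ker, (mem_ker_whittakerChar_iff ψ _).1 h2ker,
        inv_one, mul_one]
    rw [biRepTwist_apply_apply, hχ, inv_one, one_mul, biAct_apply, Prod.fst_inv, Prod.snd_inv,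
      Subgroup.coe_inv, Subgroup.coe_inv, inv_inv]
    have h2K' : (h.2 : GL (Fin n) F) ∈ K := h2K
    have h1K' : (h.1 : GL (Fin n) F) ∈ K := h1K
    rw [hR _ h2K', hL _ (K.inv_mem h1K')]

/-! ### Twisted averaging over `V₀ × V₀` -/

variable (V₀ : Subgroup ↥(upperUnitriangular (Fin n) F))

/-- **The twisted averaging operator** `e f = e_{V₀ × V₀} f = ∫_{V₀ × V₀} biChar(h)⁻¹ (h · f) dh`
(the tree's `Representation.avgProj`, a normalised finite transversal sum; Bump 1997, Prop. 4.3.2,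
p. 441: averaging a test function over a compact open subgroup against a character).
[cite: Bump1997, Proposition 4.3.2, p. 441] -/
noncomputable def biAvg (f : SchwartzBruhat (GL (Fin n) F)) : SchwartzBruhat (GL (Fin n) F) :=
  (biRepTwist ψ).avgProj (V₀.prod V₀) f

omit [ValuativeRel F] [IsNonarchimedeanLocalField F] in
/-- `V₀ × V₀` is compact when `V₀` is. [folklore] -/
lemma isCompact_prod_of_isCompact (hV₀ : IsCompact (V₀ : Set ↥(upperUnitriangular (Fin n) F))) :
    IsCompact ((V₀.prod V₀ : Subgroup (↥(upperUnitriangular (Fin n) F) × ↥(upperUnitriangular (Fin n) F))) :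
      Set (↥(upperUnitriangular (Fin n) F) × ↥(upperUnitriangular (Fin n) F))) := by
  rw [Subgroup.coe_prod]; exact hV₀.prod hV₀

/-- **The averaging operator as a transversal sum, simultaneously for two test functions**:
there is a finite `R ⊆ V₀ × V₀`, `R ≠ ∅`, with `e f = #R⁻¹ ∑_{r ∈ R} biChar(r)⁻¹ (r · f)` and the
same for `g`. [folklore] -/
theorem exists_biAvg_eq_sum₂ (hψ : Continuous ψ) (hV₀ : IsCompact (V₀ : Set ↥(upperUnitriangular (Fin n) F)))
    (f g : SchwartzBruhat (GL (Fin n) F)) :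
    ∃ R : Finset (↥(upperUnitriangular (Fin n) F) × ↥(upperUnitriangular (Fin n) F)),
      R.Nonempty ∧ (∀ r ∈ R, r ∈ V₀.prod V₀) ∧
      biAvg ψ V₀ f = ((R.card : ℂ))⁻¹ • ∑ r ∈ R, biRepTwist ψ r f ∧
      biAvg ψ V₀ g = ((R.card : ℂ))⁻¹ • ∑ r ∈ R, biRepTwist ψ r g := by
  set T := (biRepTwist ψ).stabilizerSubgroup f ⊓ (biRepTwist ψ).stabilizerSubgroup g with hT
  have hTo : IsOpen (T : Set (↥(upperUnitriangular (Fin n) F) × ↥(upperUnitriangular (Fin n) F))) :=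
    (isSmoothVector_biRepTwist ψ hψ f).inter (isSmoothVector_biRepTwist ψ hψ g)
  obtain ⟨R, hR⟩ := exists_isLeftTransversal (B := V₀.prod V₀) (isCompact_prod_of_isCompact V₀ hV₀) hTo
  refine ⟨R, hR.nonempty, hR.mem_of_mem, ?_, ?_⟩
  · exact Representation.avgProj_eq (isCompact_prod_of_isCompact V₀ hV₀) hTo
      (fun t ht => (Representation.mem_stabilizerSubgroup _ _ t).1 ht.1) hR
  · exact Representation.avgProj_eq (isCompact_prod_of_isCompact V₀ hV₀) hTo
      (fun t ht => (Representation.mem_stabilizerSubgroup _ _ t).1 ht.2) hR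

/-- Pointwise evaluation of a transversal sum. [folklore] -/
lemma sum_biRepTwist_apply (R : Finset (↥(upperUnitriangular (Fin n) F) × ↥(upperUnitriangular (Fin n) F)))
    (f : SchwartzBruhat (GL (Fin n) F)) (x : GL (Fin n) F) :
    ((((R.card : ℂ))⁻¹ • ∑ r ∈ R, biRepTwist ψ r f : SchwartzBruhat (GL (Fin n) F)) : GL (Fin n) F → ℂ) x =
      ((R.card : ℂ))⁻¹ * ∑ r ∈ R, ((biChar ψ r : ℂˣ) : ℂ)⁻¹ * (f : GL (Fin n) F → ℂ) (biAct r⁻¹ x) := by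
  simp only [Submodule.coe_smul, Submodule.coe_sum, Pi.smul_apply, Finset.sum_apply, smul_eq_mul,
    biRepTwist_apply_apply]

/-- **`f - e f ∈ biRelations ψ`** (`f - e f = #R⁻¹ ∑_r (f - biChar(r)⁻¹ r · f)`; Bernstein–Zelevinsky
1976, 2.33; Bump 1997, Prop. 4.4.1 — the easy half of Jacquet's lemma, twisted).
[cite: Bump1997, Proposition 4.4.1 (PDF p. 460)] -/
theorem sub_biAvg_mem_biRelations (hψ : Continuous ψ) (hV₀ : IsCompact (V₀ : Set ↥(upperUnitriangular (Fin n) F)))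
    (f : SchwartzBruhat (GL (Fin n) F)) : f - biAvg ψ V₀ f ∈ biRelations ψ := by
  obtain ⟨R, hRne, -, hRf, -⟩ := exists_biAvg_eq_sum₂ ψ V₀ hψ hV₀ f f
  have hcard : (R.card : ℂ) ≠ 0 := Nat.cast_ne_zero.2 (Finset.card_ne_zero.2 hRne)
  have key : f - biAvg ψ V₀ f = ((R.card : ℂ))⁻¹ • ∑ r ∈ R, (f - biRepTwist ψ r f) := by
    rw [Finset.sum_sub_distrib, Finset.sum_const, ← Nat.cast_smul_eq_nsmul ℂ, smul_sub, smul_smul,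
      inv_mul_cancel₀ hcard, one_smul, hRf]
  rw [key]
  refine Submodule.smul_mem _ _ (Submodule.sum_mem _ fun r _ => ?_)
  have : f - biRepTwist ψ r f = -((((biChar ψ r)⁻¹ : ℂˣ) : ℂ) • (biRep r f - (biChar ψ r : ℂ) • f)) := by
    rw [biRepTwist_apply, smul_sub, smul_smul, Units.inv_mul, one_smul]; abel
  rw [this]
  exact Submodule.neg_mem _ (Submodule.smul_mem _ _ (biRep_sub_smul_mem_biRelations ψ r f))

/-- **Transformation rule**: `(e f)(h · x) = biChar(h)⁻¹ (e f)(x)` for `h ∈ V₀ × V₀` (the average is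
a `(V₀ × V₀, biChar)`-quasi-invariant test function). [cite: Bump1997, Proposition 4.3.2, p. 441] -/
theorem biAvg_apply_biAct (hψ : Continuous ψ) (hV₀ : IsCompact (V₀ : Set ↥(upperUnitriangular (Fin n) F)))
    (f : SchwartzBruhat (GL (Fin n) F))
    {h : ↥(upperUnitriangular (Fin n) F) × ↥(upperUnitriangular (Fin n) F)} (hh : h ∈ V₀.prod V₀)
    (x : GL (Fin n) F) :
    (biAvg ψ V₀ f : GL (Fin n) F → ℂ) (biAct h x) = ((biChar ψ h : ℂˣ) : ℂ)⁻¹ * (biAvg ψ V₀ f : GL (Fin n) F → ℂ) x := by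
  have h1 := Representation.apply_avgProj (ρ := biRepTwist ψ) (isCompact_prod_of_isCompact V₀ hV₀)
    (isSmoothVector_biRepTwist ψ hψ f) ((V₀.prod V₀).inv_mem hh)
  have h2 := congrArg (fun φ : SchwartzBruhat (GL (Fin n) F) => (φ : GL (Fin n) F → ℂ) x) h1
  simp only [biRepTwist_apply_apply, inv_inv, map_inv, Units.val_inv_eq_inv_val] at h2
  change ((biChar ψ h : ℂˣ) : ℂ) * (biAvg ψ V₀ f : GL (Fin n) F → ℂ) (biAct h x) =
    (biAvg ψ V₀ f : GL (Fin n) F → ℂ) x at h2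
  rw [← h2, ← mul_assoc, inv_mul_cancel₀ (Units.ne_zero _), one_mul]

/-- **Support rule**: if `(e f)(y) ≠ 0` then `f(r⁻¹ · y) ≠ 0` for some `r ∈ V₀ × V₀`. [folklore] -/
theorem exists_apply_ne_zero_of_biAvg_ne_zero (hψ : Continuous ψ)
    (hV₀ : IsCompact (V₀ : Set ↥(upperUnitriangular (Fin n) F))) (f : SchwartzBruhat (GL (Fin n) F))
    {y : GL (Fin n) F} (hy : (biAvg ψ V₀ f : GL (Fin n) F → ℂ) y ≠ 0) :
    ∃ r ∈ V₀.prod V₀, (f : GL (Fin n) F → ℂ) (biAct r⁻¹ y) ≠ 0 := by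
  obtain ⟨R, -, hRV, hRf, -⟩ := exists_biAvg_eq_sum₂ ψ V₀ hψ hV₀ f f
  rw [hRf, sum_biRepTwist_apply] at hy
  obtain ⟨r, hr, hr0⟩ := Finset.exists_ne_zero_of_sum_ne_zero (right_ne_zero_of_mul hy)
  exact ⟨r, hRV r hr, right_ne_zero_of_mul hr0⟩

/-! ### `τ`-stable compact open subgroups of `U_n` -/

/-- `τ` as an automorphism of the group `U_n`. [folklore] -/
noncomputable def tauUHom : ↥(upperUnitriangular (Fin n) F) →* ↥(upperUnitriangular (Fin n) F) where
  toFun := tauU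
  map_one' := tauU_one
  map_mul' := tauU_mul

omit [ValuativeRel F] [IsNonarchimedeanLocalField F] in
/-- `tauUHom` is `tauU`. [folklore] -/
@[simp] lemma tauUHom_apply (u : ↥(upperUnitriangular (Fin n) F)) : tauUHom u = tauU u := rfl

omit [ValuativeRel F] [IsNonarchimedeanLocalField F] in
/-- `τ` is continuous on `U_n`. [folklore] -/
lemma continuous_tauU [IsTopologicalRing F] : Continuous (tauU (F := F) (n := n)) :=
  Continuous.subtype_mk (continuous_gkInvolution.comp (continuous_subtype_val.inv)) _

/-- **Every compact subset of `U_n` lies in a `τ`-stable compact open subgroup** (`U_n` is the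
union of its compact open subgroups, `isLimitOfCompactOpen_upperUnitriangular`; the subgroup
generated by `V₁ ∪ τ(V₁)` inside a larger compact open subgroup is compact, open and `τ`-stable).
[cite: BernsteinZelevinskyASENS1977, §1.9] -/
theorem exists_tauStable_compactOpen_subgroup {C : Set ↥(upperUnitriangular (Fin n) F)} (hC : IsCompact C) :
    ∃ V₀ : Subgroup ↥(upperUnitriangular (Fin n) F), IsOpen (V₀ : Set ↥(upperUnitriangular (Fin n) F)) ∧
      IsCompact (V₀ : Set ↥(upperUnitriangular (Fin n) F)) ∧ C ⊆ V₀ ∧ ∀ u ∈ V₀, tauU u ∈ V₀ := by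
  haveI : T2Space F := (GaloisRepresentations.IsNonarchimedeanLocalField.isLocalField F).toT2Space
  obtain ⟨V₁, hV₁o, hV₁c, hCV₁⟩ := isLimitOfCompactOpen_upperUnitriangular (F := F) (n := n) C hC
  set S : Set ↥(upperUnitriangular (Fin n) F) := (V₁ : Set _) ∪ tauU '' (V₁ : Set _) with hS
  have hSc : IsCompact S := hV₁c.union (hV₁c.image continuous_tauU)
  obtain ⟨V₃, hV₃o, hV₃c, hSV₃⟩ := isLimitOfCompactOpen_upperUnitriangular (F := F) (n := n) S hSc
  set V₂ : Subgroup ↥(upperUnitriangular (Fin n) F) := Subgroup.closure S with hV₂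
  have hV₁V₂ : V₁ ≤ V₂ := fun u hu => Subgroup.subset_closure (Or.inl hu)
  have hV₂V₃ : V₂ ≤ V₃ := (Subgroup.closure_le _).2 hSV₃
  have hV₂o : IsOpen (V₂ : Set ↥(upperUnitriangular (Fin n) F)) := Subgroup.isOpen_mono hV₁V₂ hV₁o
  have hV₂c : IsCompact (V₂ : Set ↥(upperUnitriangular (Fin n) F)) :=
    hV₃c.of_isClosed_subset (V₂.isClosed_of_isOpen hV₂o) hV₂V₃
  have hτS : tauUHom '' S = S := by
    ext u
    simp only [hS, Set.mem_image, Set.mem_union, tauUHom_apply]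
    constructor
    · rintro ⟨v, hv | ⟨w, hw, rfl⟩, rfl⟩
      · exact Or.inr ⟨v, hv, rfl⟩
      · rw [tauU_tauU]; exact Or.inl hw
    · rintro (hu | ⟨w, hw, rfl⟩)
      · exact ⟨tauU u, Or.inr ⟨u, hu, rfl⟩, tauU_tauU u⟩
      · exact ⟨w, Or.inl hw, rfl⟩
  have hmap : V₂.map tauUHom = V₂ := by
    rw [hV₂, MonoidHom.map_closure, hτS]
  refine ⟨V₂, hV₂o, hV₂c, hCV₁.trans hV₁V₂, fun u hu => ?_⟩
  have : tauUHom u ∈ V₂.map tauUHom := Subgroup.mem_map_of_mem _ hu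
  rwa [hmap] at this

omit [ValuativeRel F] [IsNonarchimedeanLocalField F] in
/-- A `τ`-stable `V₀` gives a `flip`-stable `V₀ × V₀`. [folklore] -/
lemma flipU_mem_prod {V₀ : Subgroup ↥(upperUnitriangular (Fin n) F)} (hτ : ∀ u ∈ V₀, tauU u ∈ V₀)
    {h : ↥(upperUnitriangular (Fin n) F) × ↥(upperUnitriangular (Fin n) F)} (hh : h ∈ V₀.prod V₀) :
    flipU h ∈ V₀.prod V₀ :=
  Subgroup.mem_prod.2 ⟨hτ _ (Subgroup.mem_prod.1 hh).2, hτ _ (Subgroup.mem_prod.1 hh).1⟩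

/-! ### The orbit lemmas on a Borel cell -/

variable {ψ V₀}

/-- **Uniformity propagates from `f` to `e f`**: if every point `y` of the cell `C_σ` with
`f(y) ≠ 0` is `h · m_y`, `h ∈ V₀ × V₀`, `m_y = (cellTorus σ y) P_σ`, then so is every point of the
cell with `(e f)(y) ≠ 0`. [folklore] -/
theorem exists_eq_biAct_of_biAvg_ne_zero (hψ : Continuous ψ)
    (hV₀ : IsCompact (V₀ : Set ↥(upperUnitriangular (Fin n) F))) {σ : Equiv.Perm (Fin n)}
    {f : SchwartzBruhat (GL (Fin n) F)}
    (hunif : ∀ y ∈ bruhatCell (K := F) σ, (f : GL (Fin n) F → ℂ) y ≠ 0 →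
      ∃ h ∈ V₀.prod V₀, y = biAct h (cellTorus σ y * permGL σ))
    {y : GL (Fin n) F} (hy : y ∈ bruhatCell (K := F) σ) (h0 : (biAvg ψ V₀ f : GL (Fin n) F → ℂ) y ≠ 0) :
    ∃ h ∈ V₀.prod V₀, y = biAct h (cellTorus σ y * permGL σ) := by
  obtain ⟨r, hr, hr0⟩ := exists_apply_ne_zero_of_biAvg_ne_zero ψ V₀ hψ hV₀ f h0
  have hy' : biAct r⁻¹ y ∈ bruhatCell (K := F) σ := by
    rw [biAct_apply]
    exact mul_mul_mem_bruhatCell σ hy (r⁻¹).1.2 (Subgroup.inv_mem _ (r⁻¹).2.2)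
  obtain ⟨h', hh', hyh'⟩ := hunif _ hy' hr0
  have hT : cellTorus σ (biAct r⁻¹ y) = cellTorus σ y := by
    rw [biAct_apply]
    exact cellTorus_mul_mul σ hy (r⁻¹).1.2 (Subgroup.inv_mem _ (r⁻¹).2.2)
  refine ⟨r * h', Subgroup.mul_mem _ hr hh', ?_⟩
  rw [biAct_mul, ← hT, ← hyh', biAct_biAct_inv]

/-- **Irrelevant orbits carry no quasi-invariant averages**: under the uniformity hypothesis, if
some `s ∈ V₀ × V₀` fixes the representative `m_y = (cellTorus σ y) P_σ` with `biChar(s) ≠ 1`, then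
`(e f)(y) = 0` (since `(e f)(m_y) = (e f)(s · m_y) = biChar(s)⁻¹ (e f)(m_y)` and
`(e f)(h · m_y) = biChar(h)⁻¹ (e f)(m_y)`). This is the vanishing of `(U × U, ψ ⊗ ψ⁻¹)`-quasi-invariant
distributions on the irrelevant double cosets (Gelfand–Kazhdan 1975, §4; Bump 1997, Prop. 4.3.3 and
p. 456). [cite: GelfandKazhdan1975, §4] [cite: Bump1997, Proposition 4.3.3, p. 441] -/
theorem biAvg_apply_eq_zero_of_stabilizer (hψ : Continuous ψ)
    (hV₀ : IsCompact (V₀ : Set ↥(upperUnitriangular (Fin n) F))) {σ : Equiv.Perm (Fin n)}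
    {f : SchwartzBruhat (GL (Fin n) F)}
    (hunif : ∀ y ∈ bruhatCell (K := F) σ, (f : GL (Fin n) F → ℂ) y ≠ 0 →
      ∃ h ∈ V₀.prod V₀, y = biAct h (cellTorus σ y * permGL σ))
    {y : GL (Fin n) F} (hy : y ∈ bruhatCell (K := F) σ)
    {s : ↥(upperUnitriangular (Fin n) F) × ↥(upperUnitriangular (Fin n) F)} (hs : s ∈ V₀.prod V₀)
    (hsm : biAct s (cellTorus σ y * permGL σ) = cellTorus σ y * permGL σ) (hχ : biChar ψ s ≠ 1) :
    (biAvg ψ V₀ f : GL (Fin n) F → ℂ) y = 0 := by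
  by_contra h0
  obtain ⟨h, hh, hyh⟩ := exists_eq_biAct_of_biAvg_ne_zero hψ hV₀ hunif hy h0
  have hm : (biAvg ψ V₀ f : GL (Fin n) F → ℂ) (cellTorus σ y * permGL σ) = 0 := by
    have h1 := biAvg_apply_biAct ψ V₀ hψ hV₀ f hs (cellTorus σ y * permGL σ)
    rw [hsm] at h1
    have hχ' : ((biChar ψ s : ℂˣ) : ℂ)⁻¹ ≠ 1 := by
      rw [Ne, inv_eq_one, Units.val_eq_one]; exact hχ
    have : (1 - ((biChar ψ s : ℂˣ) : ℂ)⁻¹) * (biAvg ψ V₀ f : GL (Fin n) F → ℂ) (cellTorus σ y * permGL σ) = 0 := by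
      rw [sub_mul, one_mul, ← h1, sub_self]
    exact (mul_eq_zero.1 this).resolve_left (sub_ne_zero.2 (Ne.symm hχ'))
  apply h0
  rw [hyh, biAvg_apply_biAct ψ V₀ hψ hV₀ f hh, hm, mul_zero]

/-- **Relevant orbits: the average is `ι`-symmetric.** On an `ι`-stable cell (`σ⋆ = σ`), under the
uniformity hypothesis and for a `τ`-stable `V₀`, if `ι` fixes the representative `m_y` then
`(e f)(ι y) = (e f)(y)`: for `y = h · m_y`, `ι y = flip(h) · m_y` and `biChar(flip h) = biChar(h)`;
otherwise both sides vanish. (Gelfand–Kazhdan 1975, §4: on the relevant double cosets the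
quasi-invariant distributions are invariant under the anti-involution; Bump 1997, pp. 456–457 for
`n = 2`.) [cite: GelfandKazhdan1975, §4] [cite: Bump1997, Theorem 4.4.2 proof, pp. 456–457] -/
theorem biAvg_apply_gkInvolution (hψ : Continuous ψ)
    (hV₀ : IsCompact (V₀ : Set ↥(upperUnitriangular (Fin n) F))) (hτ : ∀ u ∈ V₀, tauU u ∈ V₀)
    {σ : Equiv.Perm (Fin n)} (hσ : starPerm σ = σ) {f : SchwartzBruhat (GL (Fin n) F)}
    (hunif : ∀ y ∈ bruhatCell (K := F) σ, (f : GL (Fin n) F → ℂ) y ≠ 0 →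
      ∃ h ∈ V₀.prod V₀, y = biAct h (cellTorus σ y * permGL σ))
    {y : GL (Fin n) F} (hy : y ∈ bruhatCell (K := F) σ)
    (hfix : gkInvolution (cellTorus σ y * permGL σ) = cellTorus σ y * permGL σ) :
    (biAvg ψ V₀ f : GL (Fin n) F → ℂ) (gkInvolution y) = (biAvg ψ V₀ f : GL (Fin n) F → ℂ) y := by
  by_cases hex : ∃ h ∈ V₀.prod V₀, y = biAct h (cellTorus σ y * permGL σ)
  · obtain ⟨h, hh, hyh⟩ := hex
    have hιy : gkInvolution y = biAct (flipU h) (cellTorus σ y * permGL σ) := by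
      conv_lhs => rw [hyh]
      rw [gkInvolution_biAct, hfix]
    rw [hιy, biAvg_apply_biAct ψ V₀ hψ hV₀ f (flipU_mem_prod hτ hh), biChar_flipU]
    conv_rhs => rw [hyh]
    rw [biAvg_apply_biAct ψ V₀ hψ hV₀ f hh]
  · -- both sides vanish
    have h1 : (biAvg ψ V₀ f : GL (Fin n) F → ℂ) y = 0 := by
      by_contra h0
      exact hex (exists_eq_biAct_of_biAvg_ne_zero hψ hV₀ hunif hy h0)
    have hιy : gkInvolution y ∈ bruhatCell (K := F) σ := by
      have := (gkInvolution_mem_bruhatCell_iff σ y).2 hy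
      rwa [hσ] at this
    have hm : cellTorus σ (gkInvolution y) * permGL σ = cellTorus σ y * permGL σ := by
      rw [← gkInvolution_cellTorus_mul_permGL hσ hy, hfix]
    have h2 : (biAvg ψ V₀ f : GL (Fin n) F → ℂ) (gkInvolution y) = 0 := by
      by_contra h0
      obtain ⟨h', hh', hιyh'⟩ := exists_eq_biAct_of_biAvg_ne_zero hψ hV₀ hunif hιy h0
      apply hex
      refine ⟨flipU h', flipU_mem_prod hτ hh', ?_⟩
      rw [hm] at hιyh'
      have := congrArg gkInvolution hιyh'
      rw [gkInvolution_gkInvolution, gkInvolution_biAct, hfix] at this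
      exact this
    rw [h1, h2]

end LocalField

end Literature.NumberTheory.Automorphic
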